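import Summits.HodgeConjecture.CorCM.Census.OcticTwistLawAll
import Summits.HodgeConjecture.CorCM.Census.OcticTwistFloor

/-!
# The octic twist `(ℤ/8 × B, (4,0))`, XXI: THE LAWS — `μ(ℤ/8 × B, (4,0)) = β − 1` for `|B|` odd, and the SANDWICH
# `β − 2 ≤ μ ≤ β − 1` for every finite group `B` of order `≥ 3`

COR-CM (cell `pub-hodgecm2`), count-neutral kernel combinatorics by the binder seat b09 (gen 34; lane COINVARIANT-TWIST / OCTIC RECON), on top of
part XV (`Census/OcticTwistFloor.lean`: `parVec₂`, `blkC`, `blkA`, `parVec₂_X`, `parVec₂_rel`, `parVec₂_mem_span_of_mem`, `card_residual_blocks_le_ten`)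
and part XX (`exists_faces_generate₂_all`) BY NAME; the pattern is gen 32ʼs quartic sandwich `Census/QuarticTwistSandwich.lean` one dimension up.
Theorems only; no definition, no certificate, no named fact, no `sorry`.
HONEST FRAMING: `HC_CM` is NOT proved, here or anywhere in the tree; nothing here is a period or a headline.

THE PARITY FLOOR FOR ANY PARITY (**`card_orb₂_le_card_add_two`**, `|B| ≥ 3`): every finite family `S` with `hodge₂ B ≤ pairs₂ B ⊔ spanMot B S` has
`β ≤ |S| + 2`.  For `|B|` even the Weil parities of part XV lose their atom component, but EIGHT residual parities stay independent: the Boolean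
lifts `X_{t+1,b₀} ⊗ e_0` (`A(t,+) + A(t+1,−) + …`), three D-moves `(e_{(ρ+1) − δ_{b₀}} − e_{ρ+1}) ⊗ (e_0 − e_{ρ+1})` (`A(ρ,−) + A(3,−) + …`,
`ρ = 0, 1, 2`) and the constant square `(e_1 − e_0) ⊗ (e_1 − e_0)` (`C(3) + C(1)`), on top of one potential-decreasing relation per block of
potential `≥ 2`.  With part XX: **`octicTwist_sandwich`** — `β − 2 ≤ μ(ℤ/8 × B, (4,0)) ≤ β − 1` for EVERY finite group `B` of order `≥ 3`, and
`= β − 1` for `|B|` odd (part XVI).  The even tie is expected to break as in the quartic chain (`μ = β − 1 − [∃ t ∈ B, 8 ∣ ord t]`; successor).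
All [folklore].

## References
* [Pohlmann1968] H. Pohlmann, Algebraic cycles on abelian varieties of complex multiplication type, Ann. of Math. 88 (1968), Thm 1.
* [Milne1999] J. S. Milne, Lefschetz motives and the Tate conjecture, Compositio Math. 117 (1999), Prop. 2.1, p. 54.
-/

namespace Summit.HodgeConjecture.CorCM.Census.OcticTwist

open Finset
open Summit.HodgeConjecture.CorCM.Census.QuarticTwist

variable (B : Type) [AddGroup B] [Fintype B] [DecidableEq B]

/-! ## §1 Parities of a general D-move and of the constant square -/

/-- **Parity of a D-move** `(e_{u+kδ_{b}} − e_u) ⊗ (e_{u′} − e_{u″})`: `A(u − u′ − 1, k) + A(u − u″ − 1, k) + C(u′ − u) + C(u″ − u)`. [folklore] -/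
theorem parVec₂_Dmove (b₀ : B) (u : ZMod 4) (b : B) (k u' u'' : ZMod 4) (ω : Orb₂ B) :
    parVec₂ B (tens B (Pi.single (atom B u b k) 1 - Pi.single (cst B u) 1) (Pi.single (cst B u') 1 - Pi.single (cst B u'') 1)) ω =
      (if ω = blkA B b₀ (u - u' - 1) k then 1 else 0) + (if ω = blkA B b₀ (u - u'' - 1) k then 1 else 0)
        + (if ω = blkC B (u' - u) then 1 else 0) + (if ω = blkC B (u'' - u) then 1 else 0) := by
  rw [tens_sub_sub]
  simp only [← single_eq_tens]
  rw [map_add, map_sub, map_sub, Pi.add_apply, Pi.sub_apply, Pi.sub_apply]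
  simp only [parVec₂_single_one, mk_atom_cst B b₀, mk_cst_cst]
  have neg2 : ∀ y : ZMod 2, -y = y := by decide
  rw [sub_eq_add_neg, neg2, sub_eq_add_neg, neg2]
  abel

/-- **Parity of the constant square** `(e_1 − e_0) ⊗ (e_1 − e_0)`: `C(3) + C(1)` (the two `C(0)` corners cancel). [folklore] -/
theorem parVec₂_ccSquare (ω : Orb₂ B) :
    parVec₂ B (tens B (Pi.single (cst B 1) 1 - Pi.single (cst B 0) 1) (Pi.single (cst B 1) 1 - Pi.single (cst B 0) 1)) ω =
      (if ω = blkC B (-1) then 1 else 0) + (if ω = blkC B 1 then 1 else 0) := by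
  rw [tens_sub_sub]
  simp only [← single_eq_tens]
  rw [map_add, map_sub, map_sub, Pi.add_apply, Pi.sub_apply, Pi.sub_apply]
  simp only [parVec₂_single_one, mk_cst_cst, sub_self, sub_zero, zero_sub]
  have neg2 : ∀ y : ZMod 2, -y = y := by decide
  have two : ∀ y : ZMod 2, y + y = 0 := by decide
  rw [sub_eq_add_neg, neg2, sub_eq_add_neg, neg2]
  have e : ∀ x y z : ZMod 2, x + y + z + x = z + y := fun x y z => by
    have h1 : x + y + z + x = (x + x) + (z + y) := by abel
    rw [h1, two, zero_add]
  exact e _ _ _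

/-! ## §2 The parity floor for any parity -/

/-- **THE PARITY FLOOR, any parity** (`|B| ≥ 3`).  If a finite family `S` of octic exponent vectors generates the octic Hodge lattice together
with the octic pairs and all motions, then `β = #Orb₂ B ≤ |S| + 2`. [folklore] -/
theorem card_orb₂_le_card_add_two (h3 : 3 ≤ Fintype.card B) (S : Finset (Ty₂ B → ℤ))
    (hS : hodge₂ B ≤ pairs₂ B ⊔ spanMot B S) : Fintype.card (Orb₂ B) ≤ S.card + 2 := by
  classical
  obtain ⟨b₀⟩ : Nonempty B := Fintype.card_pos_iff.mp (by omega)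
  set T := Submodule.span (ZMod 2) ((S.image (parVec₂ B) : Finset _) : Set (Orb₂ B → ZMod 2)) with hT
  have hT' : Module.finrank (ZMod 2) T ≤ S.card := (finrank_span_finset_le_card _).trans Finset.card_image_le
  let NRt := {ω : Orb₂ B // 2 ≤ potOrb B ω}
  have hrep : ∀ ω : NRt, 2 ≤ pot B ω.1.out := by
    intro ω
    have h := ω.2
    rw [← Quotient.out_eq ω.1, potOrb_mk] at h
    exact h
  choose T₁ T₂ T₃ hF hP₁ hP₂ hP₃ using fun ω : NRt => exists_rel B h3 ω.1.out (hrep ω)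
  -- casts of `Fin 3` into `ℤ/4`
  have cast3 : (∀ r : Fin 3, ((r : ℕ) : ZMod 4) ≠ -1) ∧ (∀ r r' : Fin 3, ((r : ℕ) : ZMod 4) = ((r' : ℕ) : ZMod 4) → r = r') := by
    refine ⟨by decide, by decide⟩
  -- the index type and the vectors
  let vec : NRt ⊕ (ZMod 4 ⊕ (Fin 3 ⊕ Unit)) → (Ty₂ B → ℤ) := fun x =>
    match x with
    | Sum.inl ω => Pi.single ω.1.out 1 - Pi.single (T₁ ω) 1 - Pi.single (T₂ ω) 1 + Pi.single (T₃ ω) 1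
    | Sum.inr (Sum.inl t) => tens B (Xvec B (t + 1) b₀) (Pi.single (cst B 0) 1)
    | Sum.inr (Sum.inr (Sum.inl r)) =>
        tens B (Pi.single (atom B (((r : ℕ) : ZMod 4) + 1) b₀ (-1)) 1 - Pi.single (cst B (((r : ℕ) : ZMod 4) + 1)) 1)
          (Pi.single (cst B 0) 1 - Pi.single (cst B (((r : ℕ) : ZMod 4) + 1)) 1)
    | Sum.inr (Sum.inr (Sum.inr _)) =>
        tens B (Pi.single (cst B 1) 1 - Pi.single (cst B 0) 1) (Pi.single (cst B 1) 1 - Pi.single (cst B 0) 1)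
  have hvecH : ∀ x, vec x ∈ hodge₂ B := by
    rintro (ω | t | r | _)
    · exact mem_hodge₂_of_isFace₂ B (hF ω)
    · exact tens_mem_hodge₂_left B (Xvec_mem B _ b₀) (sum_Xvec B _ b₀) _
    · exact tens_mem_hodge₂_of_sum_eq_zero B (sum_single_sub_single B _ _) (sum_single_sub_single B _ _)
    · exact tens_mem_hodge₂_of_sum_eq_zero B (sum_single_sub_single B _ _) (sum_single_sub_single B _ _)
  have hmem : ∀ x, parVec₂ B (vec x) ∈ T := fun x => parVec₂_mem_span_of_mem B S (hS (hvecH x))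
  -- parity formulas
  have vX : ∀ (t : ZMod 4) (ω : Orb₂ B), parVec₂ B (vec (Sum.inr (Sum.inl t))) ω =
      (if ω = blkA B b₀ t 1 then 1 else 0) + (if ω = blkA B b₀ (t + 1) (-1) then 1 else 0)
        + (if ω = blkC B (-(t + 1)) then 1 else 0) + (if ω = blkC B (-(t + 1) - 1) then 1 else 0) := by
    intro t ω
    show parVec₂ B (tens B (Xvec B (t + 1) b₀) (Pi.single (cst B 0) 1)) ω = _
    rw [parVec₂_X B b₀, add_sub_cancel_right]
  have vD : ∀ (r : Fin 3) (ω : Orb₂ B), parVec₂ B (vec (Sum.inr (Sum.inr (Sum.inl r)))) ω =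
      (if ω = blkA B b₀ ((r : ℕ) : ZMod 4) (-1) then 1 else 0) + (if ω = blkA B b₀ (-1) (-1) then 1 else 0)
        + (if ω = blkC B (0 - (((r : ℕ) : ZMod 4) + 1)) then 1 else 0) + (if ω = blkC B 0 then 1 else 0) := by
    intro r ω
    show parVec₂ B (tens B (Pi.single (atom B (((r : ℕ) : ZMod 4) + 1) b₀ (-1)) 1 - Pi.single (cst B (((r : ℕ) : ZMod 4) + 1)) 1)
      (Pi.single (cst B 0) 1 - Pi.single (cst B (((r : ℕ) : ZMod 4) + 1)) 1)) ω = _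
    rw [parVec₂_Dmove B b₀, show ((r : ℕ) : ZMod 4) + 1 - 0 - 1 = ((r : ℕ) : ZMod 4) by ring,
      show ((r : ℕ) : ZMod 4) + 1 - (((r : ℕ) : ZMod 4) + 1) - 1 = -1 by ring, sub_self]
  have vC : ∀ ω : Orb₂ B, parVec₂ B (vec (Sum.inr (Sum.inr (Sum.inr ())))) ω =
      (if ω = blkC B (-1) then 1 else 0) + (if ω = blkC B 1 then 1 else 0) := fun ω => parVec₂_ccSquare B ω
  -- residual blocks are not blocks of potential `≥ 2`
  have resA : ∀ (ω : NRt) (ρ k : ZMod 4), (k = 1 ∨ k = -1) → (ω.1 : Orb₂ B) ≠ blkA B b₀ ρ k := by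
    intro ω ρ k hk h
    have := (potOrb_blk B h3 b₀ 0 ρ hk).2
    have h2 := ω.2
    rw [h] at h2
    omega
  have resC : ∀ (ω : NRt) (d : ZMod 4), (ω.1 : Orb₂ B) ≠ blkC B d := by
    intro ω d h
    have := (potOrb_blk B h3 b₀ d 0 (Or.inl rfl)).1
    have h2 := ω.2
    rw [h] at h2
    omega
  have m1 : (-1 : ZMod 4) = 1 ∨ (-1 : ZMod 4) = -1 := Or.inr rfl
  have p1 : (1 : ZMod 4) = 1 ∨ (1 : ZMod 4) = -1 := Or.inl rfl
  have AA : ∀ (ρ ρ' k k' : ZMod 4), k ≠ 0 → (blkA B b₀ ρ k = blkA B b₀ ρ' k' ↔ ρ = ρ' ∧ k = k') :=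
    fun ρ ρ' k k' hk => blkA_eq_blkA_iff B h3 b₀ hk
  have AC : ∀ (ρ k d : ZMod 4), k ≠ 0 → blkA B b₀ ρ k ≠ blkC B d :=
    fun ρ k d hk => blkA_ne_blkC B h3 b₀ ρ hk d
  have CC : ∀ d d' : ZMod 4, blkC B d = blkC B d' ↔ d = d' ∨ d = -d' - 1 := fun d d' => blkC_eq_blkC_iff B d d'
  have k1 : (1 : ZMod 4) ≠ 0 := by decide
  have km : (-1 : ZMod 4) ≠ 0 := by decide
  -- linear independence
  have hli : LinearIndependent (ZMod 2) (fun x => parVec₂ B (vec x)) := by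
    rw [Fintype.linearIndependent_iff]
    intro g hsum
    have heval : ∀ ω : Orb₂ B, (∑ ωn : NRt, g (Sum.inl ωn) * parVec₂ B (vec (Sum.inl ωn)) ω)
        + ((∑ t : ZMod 4, g (Sum.inr (Sum.inl t)) * parVec₂ B (vec (Sum.inr (Sum.inl t))) ω)
          + ((∑ r : Fin 3, g (Sum.inr (Sum.inr (Sum.inl r))) * parVec₂ B (vec (Sum.inr (Sum.inr (Sum.inl r)))) ω)
            + g (Sum.inr (Sum.inr (Sum.inr ()))) * parVec₂ B (vec (Sum.inr (Sum.inr (Sum.inr ())))) ω)) = 0 := by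
      intro ω
      have h := congrFun hsum ω
      rw [Finset.sum_apply, Fintype.sum_sum_type, Fintype.sum_sum_type, Fintype.sum_sum_type] at h
      simp only [Pi.smul_apply, smul_eq_mul, Pi.zero_apply, Finset.univ_unique, Finset.sum_singleton] at h
      exact h
    -- (a) the non-residual coefficients vanish
    have hnr : ∀ ωn : NRt, g (Sum.inl ωn) = 0 := by
      by_contra hne
      obtain ⟨ω₁, hω₁⟩ := not_forall.mp hne
      obtain ⟨ω₀, hω₀, hmax⟩ := Finset.exists_max_image (univ.filter fun ωn : NRt => g (Sum.inl ωn) ≠ 0)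
        (fun ωn => potOrb B ωn.1) ⟨ω₁, mem_filter.mpr ⟨mem_univ _, hω₁⟩⟩
      have hg₀ : g (Sum.inl ω₀) ≠ 0 := (mem_filter.mp hω₀).2
      have hs₀ : ω₀.1.out ∈ orbSet₂ B ω₀.1 := (mem_orbSet₂ B).mpr (Quotient.out_eq _)
      have h := heval ω₀.1
      rw [vC, if_neg (resC ω₀ (-1)), if_neg (resC ω₀ 1), add_zero, mul_zero, add_zero] at h
      have hXz : ∀ t : ZMod 4, g (Sum.inr (Sum.inl t)) * parVec₂ B (vec (Sum.inr (Sum.inl t))) ω₀.1 = 0 := by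
        intro t
        rw [vX, if_neg (resA ω₀ t 1 p1), if_neg (resA ω₀ (t + 1) (-1) m1), if_neg (resC ω₀ _), if_neg (resC ω₀ _), add_zero,
          add_zero, add_zero, mul_zero]
      have hDz : ∀ r : Fin 3, g (Sum.inr (Sum.inr (Sum.inl r))) * parVec₂ B (vec (Sum.inr (Sum.inr (Sum.inl r)))) ω₀.1 = 0 := by
        intro r
        rw [vD, if_neg (resA ω₀ _ (-1) m1), if_neg (resA ω₀ (-1) (-1) m1), if_neg (resC ω₀ _), if_neg (resC ω₀ _), add_zero,
          add_zero, add_zero, mul_zero]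
      rw [Finset.sum_eq_zero (fun t _ => hXz t), Finset.sum_eq_zero (fun r _ => hDz r), zero_add, add_zero] at h
      have hterm : ∀ ωn : NRt, g (Sum.inl ωn) * parVec₂ B (vec (Sum.inl ωn)) ω₀.1 = if ωn = ω₀ then g (Sum.inl ω₀) else 0 := by
        intro ωn
        by_cases hgn : g (Sum.inl ωn) = 0
        · rw [hgn, zero_mul]; split_ifs with h' <;> [rw [← h', hgn]; rfl]
        · have hle : potOrb B ωn.1 ≤ potOrb B ω₀.1 := hmax ωn (mem_filter.mpr ⟨mem_univ _, hgn⟩)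
          have hpot : pot B ωn.1.out ≤ potOrb B ω₀.1 := by rw [← Quotient.out_eq ωn.1, potOrb_mk] at hle; exact hle
          rw [show vec (Sum.inl ωn) = Pi.single ωn.1.out 1 - Pi.single (T₁ ωn) 1 - Pi.single (T₂ ωn) 1 + Pi.single (T₃ ωn) 1
              from rfl, parVec₂_rel B (hP₁ ωn) (hP₂ ωn) (hP₃ ωn) ω₀.1 hpot]
          by_cases hωω : ωn = ω₀
          · subst hωω; rw [if_pos hs₀, if_pos rfl, mul_one]
          · have hnot : ωn.1.out ∉ orbSet₂ B ω₀.1 := by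
              intro hin
              exact hωω (Subtype.ext (((mem_orbSet₂ B).mp hin).symm ▸ (Quotient.out_eq ωn.1).symm ▸ rfl))
            rw [if_neg hnot, if_neg hωω, mul_zero]
      rw [Finset.sum_congr rfl (fun ωn _ => hterm ωn), Finset.sum_ite_eq' univ ω₀, if_pos (mem_univ _)] at h
      exact hg₀ h
    have hrest : ∀ ω : Orb₂ B, (∑ t : ZMod 4, g (Sum.inr (Sum.inl t)) * parVec₂ B (vec (Sum.inr (Sum.inl t))) ω)
        + ((∑ r : Fin 3, g (Sum.inr (Sum.inr (Sum.inl r))) * parVec₂ B (vec (Sum.inr (Sum.inr (Sum.inl r)))) ω)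
          + g (Sum.inr (Sum.inr (Sum.inr ()))) * parVec₂ B (vec (Sum.inr (Sum.inr (Sum.inr ())))) ω) = 0 := by
      intro ω
      have h := heval ω
      rw [Finset.sum_eq_zero (fun ωn _ => by rw [hnr ωn, zero_mul]), zero_add] at h
      exact h
    -- (b) the Boolean lifts: evaluate at `A(ρ, +1)`
    have hX : ∀ t : ZMod 4, g (Sum.inr (Sum.inl t)) = 0 := by
      intro ρ
      have h := hrest (blkA B b₀ ρ 1)
      have hXt : ∀ t : ZMod 4, g (Sum.inr (Sum.inl t)) * parVec₂ B (vec (Sum.inr (Sum.inl t))) (blkA B b₀ ρ 1)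
          = if ρ = t then g (Sum.inr (Sum.inl t)) else 0 := by
        intro t
        rw [vX, if_neg (AC ρ 1 (-(t + 1)) k1), if_neg (AC ρ 1 (-(t + 1) - 1) k1), add_zero, add_zero,
          if_neg (show ¬ blkA B b₀ ρ 1 = blkA B b₀ (t + 1) (-1) from fun h' => absurd ((AA _ _ _ _ k1).mp h').2 (by decide)),
          add_zero]
        by_cases hρt : ρ = t
        · rw [if_pos ((AA _ _ _ _ k1).mpr ⟨hρt, rfl⟩), if_pos hρt, mul_one]
        · rw [if_neg (fun h' => hρt ((AA _ _ _ _ k1).mp h').1), if_neg hρt, mul_zero]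
      have hDz : ∀ r : Fin 3, g (Sum.inr (Sum.inr (Sum.inl r))) * parVec₂ B (vec (Sum.inr (Sum.inr (Sum.inl r)))) (blkA B b₀ ρ 1) = 0 := by
        intro r
        rw [vD, if_neg (show ¬ blkA B b₀ ρ 1 = blkA B b₀ ((r : ℕ) : ZMod 4) (-1) from fun h' => absurd ((AA _ _ _ _ k1).mp h').2 (by decide)),
          if_neg (show ¬ blkA B b₀ ρ 1 = blkA B b₀ (-1) (-1) from fun h' => absurd ((AA _ _ _ _ k1).mp h').2 (by decide)),
          if_neg (AC ρ 1 _ k1), if_neg (AC ρ 1 0 k1), add_zero, add_zero, add_zero, mul_zero]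
      have hCz : g (Sum.inr (Sum.inr (Sum.inr ()))) * parVec₂ B (vec (Sum.inr (Sum.inr (Sum.inr ())))) (blkA B b₀ ρ 1) = 0 := by
        rw [vC, if_neg (AC ρ 1 (-1) k1), if_neg (AC ρ 1 1 k1), add_zero, mul_zero]
      rw [Finset.sum_congr rfl (fun t _ => hXt t), Finset.sum_ite_eq univ ρ, if_pos (mem_univ _),
        Finset.sum_eq_zero (fun r _ => hDz r), hCz, add_zero, add_zero] at h
      exact h
    have hrest' : ∀ ω : Orb₂ B, (∑ r : Fin 3, g (Sum.inr (Sum.inr (Sum.inl r))) * parVec₂ B (vec (Sum.inr (Sum.inr (Sum.inl r)))) ω)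
        + g (Sum.inr (Sum.inr (Sum.inr ()))) * parVec₂ B (vec (Sum.inr (Sum.inr (Sum.inr ())))) ω = 0 := by
      intro ω
      have h := hrest ω
      have hXz : ∑ t : ZMod 4, g (Sum.inr (Sum.inl t)) * parVec₂ B (vec (Sum.inr (Sum.inl t))) ω = 0 :=
        Finset.sum_eq_zero (fun t _ => by rw [hX t, zero_mul])
      rw [hXz, zero_add] at h
      exact h
    -- (c) the three D-moves: evaluate at `A(ρ, −1)`, `ρ = 0, 1, 2`
    have hD : ∀ r : Fin 3, g (Sum.inr (Sum.inr (Sum.inl r))) = 0 := by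
      intro r₀
      have h := hrest' (blkA B b₀ ((r₀ : ℕ) : ZMod 4) (-1))
      have hDt : ∀ r : Fin 3, g (Sum.inr (Sum.inr (Sum.inl r))) * parVec₂ B (vec (Sum.inr (Sum.inr (Sum.inl r))))
          (blkA B b₀ ((r₀ : ℕ) : ZMod 4) (-1)) = if r₀ = r then g (Sum.inr (Sum.inr (Sum.inl r))) else 0 := by
        intro r
        rw [vD, if_neg (show ¬ blkA B b₀ ((r₀ : ℕ) : ZMod 4) (-1) = blkA B b₀ (-1) (-1) from
            fun h' => cast3.1 r₀ ((AA _ _ _ _ km).mp h').1),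
          if_neg (AC _ (-1) _ km), if_neg (AC _ (-1) 0 km), add_zero, add_zero, add_zero]
        by_cases hrr : r₀ = r
        · subst hrr; rw [if_pos rfl, if_pos rfl, mul_one]
        · rw [if_neg (fun h' => hrr (cast3.2 r₀ r ((AA _ _ _ _ km).mp h').1)), if_neg hrr, mul_zero]
      have hCz : g (Sum.inr (Sum.inr (Sum.inr ()))) * parVec₂ B (vec (Sum.inr (Sum.inr (Sum.inr ()))))
          (blkA B b₀ ((r₀ : ℕ) : ZMod 4) (-1)) = 0 := by
        rw [vC, if_neg (AC _ (-1) (-1) km), if_neg (AC _ (-1) 1 km), add_zero, mul_zero]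
      rw [Finset.sum_congr rfl (fun r _ => hDt r), Finset.sum_ite_eq univ r₀, if_pos (mem_univ _), hCz, add_zero] at h
      exact h
    -- (d) the constant square: evaluate at `C(0)`
    have hC : g (Sum.inr (Sum.inr (Sum.inr ()))) = 0 := by
      have h := hrest' (blkC B 0)
      have hDz : ∑ r : Fin 3, g (Sum.inr (Sum.inr (Sum.inl r))) * parVec₂ B (vec (Sum.inr (Sum.inr (Sum.inl r)))) (blkC B 0) = 0 :=
        Finset.sum_eq_zero (fun r _ => by rw [hD r, zero_mul])
      have yC3 : blkC B 0 = blkC B (-1) := (CC 0 (-1)).mpr (Or.inr (by decide))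
      have nC1 : ¬ blkC B 0 = blkC B 1 := fun h' => absurd ((CC 0 1).mp h') (by decide)
      rw [hDz, zero_add, vC, if_pos yC3, if_neg nC1, add_zero, mul_one] at h
      exact h
    rintro (ω | t | r | u)
    · exact hnr ω
    · exact hX t
    · exact hD r
    · cases u; exact hC
  -- count
  have hli' : LinearIndependent (ZMod 2) (fun x => (⟨_, hmem x⟩ : T)) := LinearIndependent.of_comp T.subtype hli
  have hcard := hli'.fintype_card_le_finrank
  simp only [Fintype.card_sum, ZMod.card, Fintype.card_fin, Fintype.card_unique] at hcard
  have hsplit : Fintype.card NRt + Fintype.card {ω : Orb₂ B // potOrb B ω ≤ 1} = Fintype.card (Orb₂ B) := card_blocks_split B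
  have hten := card_residual_blocks_le_ten B h3
  omega

/-! ## §3 The laws -/

/-- **THE OCTIC-TWIST LAW FOR `|B|` ODD** (`≥ 3`).  (i) There is a family of exactly `β − 1` octic rank-four faces (coset faces and mixed
faces) whose motions generate the octic Hodge lattice of `(ℤ/8 × B, (4,0))` modulo the octic pairs, integrally, and (ii) no finite family of
fewer exponent vectors of any kind does: `μ(ℤ/8 × B, (4,0)) = β − 1` EXACTLY (parts XV + XVI). [folklore] -/
theorem octicTwist_law_eq (hB : Odd (Fintype.card B)) (h3 : 3 ≤ Fintype.card B) :
    (∃ S : Finset (Ty₂ B → ℤ), (∀ f ∈ S, IsFace₂ B f) ∧ hodge₂ B ≤ pairs₂ B ⊔ spanMot B S ∧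
        S.card + 1 = Fintype.card (Orb₂ B)) ∧
      ∀ S : Finset (Ty₂ B → ℤ), hodge₂ B ≤ pairs₂ B ⊔ spanMot B S → Fintype.card (Orb₂ B) ≤ S.card + 1 := by
  refine ⟨?_, fun S hS => card_orb₂_le_card_add_one B hB h3 S hS⟩
  obtain ⟨S, hface, hgen, hcard⟩ := exists_faces_generate₂ B hB h3
  exact ⟨S, hface, hgen, le_antisymm hcard (card_orb₂_le_card_add_one B hB h3 S hgen)⟩


/-- **THE OCTIC SANDWICH** (`|B| ≥ 3`, any parity): (i) some family of octic rank-four faces with `|S| + 1 ≤ β` generates `hodge₂` modulo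
`pairs₂` under the motions, and (ii) every generating family of exponent vectors has `β ≤ |S| + 2`:  `β − 2 ≤ μ(ℤ/8 × B, (4,0)) ≤ β − 1`
(`= β − 1` for `|B|` odd, part XVI). [folklore] -/
theorem octicTwist_sandwich (h3 : 3 ≤ Fintype.card B) :
    (∃ S : Finset (Ty₂ B → ℤ), (∀ f ∈ S, IsFace₂ B f) ∧ hodge₂ B ≤ pairs₂ B ⊔ spanMot B S ∧ S.card + 1 ≤ Fintype.card (Orb₂ B)) ∧
      ∀ S : Finset (Ty₂ B → ℤ), hodge₂ B ≤ pairs₂ B ⊔ spanMot B S → Fintype.card (Orb₂ B) ≤ S.card + 2 :=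
  ⟨exists_faces_generate₂_all B h3, fun S hS => card_orb₂_le_card_add_two B h3 S hS⟩

end Summit.HodgeConjecture.CorCM.Census.OcticTwist
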